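import Summits.RiemannHypothesis.RiemannHypothesis.Theorems.PfPersistenceF3SharpLocalBound

/-!
# F3 — FE-honest twins `ζ·(1 + b p^{-s} + p^{1-2s})` — part 4/5: TEMPERED case, auxiliary lemmas — pub-rhpf fake-3

HONEST FRAMING: mechanism/rigidity campaign; no RH claims.  Split of the single staged module `HOME/lean/PFPersistence/F3SharpLocal.lean` v3 (sha16 1e7c8001eda6007d,
1050 lines, `lean check` rc 0 / 0 sorries) into five ≤ 400-line modules for the gate's line lint (REFEREE r10-b):
`…F3SharpLocalDatum` (datum, SHAPE-TWIN identity, the three statements) → `…F3SharpLocalTwin` (generic twin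
lemmas) → `…F3SharpLocalBound` (THEOREM F3-A) → `…F3SharpLocalTemperedAux` (Newton sums, prime-term difference,
PSD autocorrelation, Fejér) → `…F3SharpLocalTempered` (TEMPERED TRANSFER).  Every `def`/`theorem` statement and
proof is verbatim from v3 (v2 3b05073fba483e09 = ADJ A25 add.3 for F3-A); only headers/imports are per-file.
This part: Newton sums `s_m = 2 (√p)^m cos(mφ)` for `|b| ≤ 2√p`, the prime-term difference on the powers of `p`,
positive-definiteness of the autocorrelation `A_g = g ⋆ g̃`, and Fejér summation of Toeplitz double sums.

LANDING NOTE (barrier-prover g2, lander per lead §H.5; gate bounce p187592 `dedup.landed`): fake-3's helper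
`F3T.sqrt_pow_nat` restated the landed `Literature.NumberTheory.Automorphic.real_sqrt_pow`, so it is inlined as a
local `have` at its single use site (`sharpLocalMass_pow`); every other statement and proof is verbatim 3d564d63fe37282f.
-/

set_option linter.dupNamespace false

noncomputable section

open MeasureTheory Set Filter Complex
open scoped Real Topology

namespace Summit.RiemannHypothesis.RiemannHypothesis.Theorems.PfPersistenceBarrier

open Literature.NumberTheory.LFunctions ExplicitDatum

/-! ### Proof of the TEMPERED TRANSFER (FAKES §3.2(c); RULING A25(c) kernel upgrade)

For `|b| ≤ 2√p` the Newton sums are `s_m = 2 (√p)^m cos(m φ)`, `cos φ = -b/(2√p)`, so the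
`P`-masses are `-2 log p · cos(m φ)` at `p^m` and the `P`-part of the form is
`2 log p · Σ_{k ∈ ℤ} cos(k φ) A_g(k log p)`, `A_g = g ⋆ g̃`.  Positive-definiteness of `A_g`
(`Σ c_n c̄_m A_g(x_n - x_m) = ∫ |Σ c_n g(· + x_n)|² ≥ 0`) and Fejér summation of the Toeplitz
double sums `Σ_{n,m<N} f(n-m) = Σ_{r<N} P_r` (`P_r` the symmetric partial sums, eventually
constant) give `Re Σ_k cos(kφ) A_g(k log p) ≥ 0`. -/

namespace F3T

open scoped ComplexConjugate

variable {g : ℝ → ℂ}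

/-! #### Newton sums in the tempered case -/

/-- Chebyshev recursion `cos((m+2)φ) = 2 cos φ cos((m+1)φ) - cos(mφ)`. [folklore] -/
theorem cos_rec (φ : ℝ) (m : ℕ) :
    Real.cos ((m + 2 : ℕ) * φ) = 2 * Real.cos φ * Real.cos ((m + 1 : ℕ) * φ) - Real.cos (m * φ) := by
  have h1 := Real.cos_add (((m + 1 : ℕ) : ℝ) * φ) φ
  have h2 := Real.cos_sub (((m + 1 : ℕ) : ℝ) * φ) φ
  have e1 : ((m + 2 : ℕ) : ℝ) * φ = ((m + 1 : ℕ) : ℝ) * φ + φ := by push_cast; ring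
  have e2 : (m : ℝ) * φ = ((m + 1 : ℕ) : ℝ) * φ - φ := by push_cast; ring
  rw [e1, e2, h1, h2]; ring

/-- Tempered Newton sums: `|b| ≤ 2√p ⇒ s_m = 2 (√p)^m cos(m·arccos(-b/(2√p)))`. [folklore] -/
theorem newtonSum_tempered {p : ℕ} (hp : p.Prime) {b : ℝ} (hb : |b| ≤ 2 * Real.sqrt p) (m : ℕ) :
    newtonSum p b m = 2 * Real.sqrt p ^ m * Real.cos (m * Real.arccos (-b / (2 * Real.sqrt p))) := by
  set φ := Real.arccos (-b / (2 * Real.sqrt p)) with hφ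
  have hsp : 0 < Real.sqrt p := Real.sqrt_pos.2 (by exact_mod_cast hp.pos)
  have h1 : |-b / (2 * Real.sqrt p)| ≤ 1 := by
    rw [abs_div, abs_neg, abs_of_pos (by positivity : (0 : ℝ) < 2 * Real.sqrt p),
      div_le_one (by positivity)]
    exact hb
  have hcos : Real.cos φ = -b / (2 * Real.sqrt p) := by
    rw [hφ, Real.cos_arccos (abs_le.1 h1).1 (abs_le.1 h1).2]
  have hb' : -b = 2 * Real.sqrt p * Real.cos φ := by
    rw [hcos]; field_simp
  have hpp : (p : ℝ) = Real.sqrt p ^ 2 := (Real.sq_sqrt (Nat.cast_nonneg p)).symm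
  suffices h : ∀ m : ℕ, newtonSum p b m = 2 * Real.sqrt p ^ m * Real.cos (m * φ) ∧
      newtonSum p b (m + 1) = 2 * Real.sqrt p ^ (m + 1) * Real.cos ((m + 1 : ℕ) * φ) from (h m).1
  intro m
  induction m with
  | zero =>
    refine ⟨by simp [newtonSum], ?_⟩
    simp only [newtonSum, zero_add, pow_one, Nat.cast_one, one_mul]
    exact hb'
  | succ m ih =>
    refine ⟨ih.2, ?_⟩
    show -b * newtonSum p b (m + 1) - p * newtonSum p b m = _
    rw [ih.1, ih.2, cos_rec]
    linear_combination (2 * Real.sqrt p ^ (m + 1) * Real.cos ((m + 1 : ℕ) * φ)) * hb' -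
      (2 * Real.sqrt p ^ m * Real.cos (m * φ)) * hpp

/-- The `P`-mass at `p^(m+1)`. [folklore] -/
theorem sharpLocalMass_pow {p : ℕ} (hp : p.Prime) (b : ℝ) (m : ℕ) :
    sharpLocalMass p b (p ^ (m + 1)) = -newtonSum p b (m + 1) * Real.log p / Real.sqrt p ^ (m + 1) := by
  have hlog : Nat.log p (p ^ (m + 1)) = m + 1 := Nat.log_pow hp.one_lt _
  have h2 : 2 ≤ p ^ (m + 1) := hp.two_le.trans (Nat.le_self_pow (Nat.succ_ne_zero m) p)
  -- `√(x^n) = (√x)^n` (fake-3's `sqrt_pow_nat`, inlined: the tree already has this statement as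
  -- `Literature.NumberTheory.Automorphic.real_sqrt_pow`, gate lint `dedup.landed` p187592)
  have sqrt_pow_nat : ∀ {x : ℝ}, 0 ≤ x → ∀ n : ℕ, Real.sqrt (x ^ n) = Real.sqrt x ^ n := by
    intro x hx n
    have : x ^ n = (Real.sqrt x ^ n) ^ 2 := by rw [← pow_mul', pow_mul, Real.sq_sqrt hx]
    rw [this, Real.sqrt_sq (pow_nonneg (Real.sqrt_nonneg _) _)]
  unfold sharpLocalMass
  rw [if_pos ⟨h2, by rw [hlog]⟩, hlog]
  push_cast
  all_goals rw [sqrt_pow_nat (Nat.cast_nonneg p)]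

/-- The Satake phase `φ = arccos(-b/(2√p))` of a tempered local factor. [folklore] -/
def phase (p : ℕ) (b : ℝ) : ℝ := Real.arccos (-b / (2 * Real.sqrt p))

/-- Tempered `P`-masses: `-2 log p · cos((m+1) φ)` at `p^(m+1)`. [folklore] -/
theorem sharpLocalMass_pow_tempered {p : ℕ} (hp : p.Prime) {b : ℝ} (hb : |b| ≤ 2 * Real.sqrt p) (m : ℕ) :
    sharpLocalMass p b (p ^ (m + 1)) = -2 * Real.log p * Real.cos ((m + 1 : ℕ) * phase p b) := by
  have hsp : 0 < Real.sqrt p := Real.sqrt_pos.2 (by exact_mod_cast hp.pos)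
  unfold phase
  rw [sharpLocalMass_pow hp, newtonSum_tempered hp hb]
  have hs : Real.sqrt p ^ (m + 1) ≠ 0 := pow_ne_zero _ hsp.ne'
  field_simp

/-! #### The prime-term difference lives on the powers of `p` -/

/-- `log (p^(m+1)) = (m+1) log p` through the casts. [folklore] -/
theorem log_natPow (p m : ℕ) : Real.log ((p ^ (m + 1) : ℕ) : ℝ) = (m + 1) * Real.log p := by
  push_cast
  rw [Real.log_pow]; push_cast; ring

/-- A nonzero `P`-mass sits at a power `p^j`, `j = Nat.log p n ≥ 1`. [folklore] -/
theorem eq_pow_of_sharpLocalMass_ne_zero {p : ℕ} {b : ℝ} {n : ℕ} (h : sharpLocalMass p b n ≠ 0) :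
    p ^ Nat.log p n = n ∧ 1 ≤ Nat.log p n := by
  unfold sharpLocalMass at h
  by_cases hc : 2 ≤ n ∧ p ^ Nat.log p n = n
  · refine ⟨hc.2, ?_⟩
    by_contra h0
    push Not at h0
    have : Nat.log p n = 0 := by omega
    have h1 := hc.2
    rw [this, pow_zero] at h1
    omega
  · exact absurd (if_neg hc) (by rwa [if_neg hc] at h)

/-- For a kernel vanishing at `|u| > R` and `R < (M+1) log p`, the prime terms of `F_{p,b}` and
`ζ` differ by the finite sum of the `P`-masses at `p, p², …, p^M`. [folklore] -/
theorem primeTerm_sub_eq_sum_pow {p : ℕ} (hp : p.Prime) (b : ℝ) {k : ℝ → ℂ} {R : ℝ}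
    (hk : ∀ u : ℝ, R < |u| → k u = 0) {M : ℕ} (hM : R < (M + 1) * Real.log p) :
    (sharpLocalDatum p b).primeTerm k - zetaDatum.primeTerm k =
      ∑ m ∈ Finset.range M, ((sharpLocalMass p b (p ^ (m + 1)) : ℝ) : ℂ) *
        (k ((m + 1) * Real.log p) + k (-((m + 1) * Real.log p))) := by
  have hlp : 0 < Real.log p := Real.log_pos (by exact_mod_cast hp.one_lt)
  have hp0 : (0 : ℝ) < p := by exact_mod_cast hp.pos
  rw [F3A.primeTerm_eq_sum_of_pos_log (F := sharpLocalDatum p b) (fun _ ↦ rfl) hk,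
    F3A.primeTerm_eq_sum_of_pos_log (F := zetaDatum) (fun _ ↦ rfl) hk, ← Finset.sum_sub_distrib]
  have hterm : ∀ n : ℕ, (sharpLocalDatum p b).wt n * (k (Real.log n) + k (-Real.log n)) -
      zetaDatum.wt n * (k (Real.log n) + k (-Real.log n)) =
      ((sharpLocalMass p b n : ℝ) : ℂ) * (k (Real.log n) + k (-Real.log n)) := by
    intro n
    show (zetaDatum.wt n + ((sharpLocalMass p b n : ℝ) : ℂ)) * _ - _ = _
    ring
  simp only [hterm]
  -- the kernel part vanishes unless `j log p ≤ R`
  have hKvan : ∀ j : ℕ, R < j * Real.log p →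
      k (j * Real.log p) + k (-(j * Real.log p)) = 0 := by
    intro j hj
    have hj0 : 0 ≤ (j : ℝ) * Real.log p := by positivity
    rw [hk _ (by rwa [abs_of_nonneg hj0]), hk _ (by rwa [abs_neg, abs_of_nonneg hj0]), add_zero]
  symm
  refine Finset.sum_bij_ne_zero (fun m _ _ ↦ p ^ (m + 1)) ?_ ?_ ?_ ?_
  · -- into `range ⌈exp(R+1)⌉₊`
    intro m hm hne
    rw [Finset.mem_range, Nat.lt_ceil]
    have hKne : k ((m + 1) * Real.log p) + k (-((m + 1) * Real.log p)) ≠ 0 := (mul_ne_zero_iff.1 hne).2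
    have hle : (m + 1) * Real.log p ≤ R := by
      by_contra hlt
      push Not at hlt
      exact hKne (by exact_mod_cast hKvan (m + 1) (by exact_mod_cast hlt))
    have : ((p ^ (m + 1) : ℕ) : ℝ) = Real.exp ((m + 1) * Real.log p) := by
      rw [← log_natPow, Real.exp_log (by exact_mod_cast pow_pos hp.pos (m + 1))]
    rw [this]
    exact (Real.exp_le_exp.2 hle).trans_lt (Real.exp_lt_exp.2 (by linarith))
  · -- injective
    intro a₁ _ _ a₂ _ _ h
    have := Nat.pow_right_injective hp.two_le h
    omega
  · -- surjective onto the nonzero terms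
    intro n hn hne
    have hmass : sharpLocalMass p b n ≠ 0 := by
      intro h0; apply hne; rw [h0]; simp
    obtain ⟨hpow, hj⟩ := eq_pow_of_sharpLocalMass_ne_zero hmass
    set j := Nat.log p n with hj_def
    have hlogn : Real.log n = j * Real.log p := by
      obtain ⟨i, hi⟩ : ∃ i, j = i + 1 := ⟨j - 1, by omega⟩
      rw [← hpow, hi, log_natPow]; push_cast; ring
    have hKne : k (Real.log n) + k (-Real.log n) ≠ 0 := (mul_ne_zero_iff.1 hne).2
    have hjM : j < M + 1 := by
      by_contra hge
      push Not at hge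
      apply hKne
      rw [hlogn]
      exact hKvan j (hM.trans_le (by exact_mod_cast mul_le_mul_of_nonneg_right (by exact_mod_cast hge) hlp.le))
    refine ⟨j - 1, Finset.mem_range.2 (by omega), ?_, ?_⟩
    · have hj1 : j - 1 + 1 = j := by omega
      rw [hj1, hpow]
      have e : ((j - 1 : ℕ) : ℝ) + 1 = j := by
        rw [Nat.cast_sub hj]; push_cast; ring
      rw [e, ← hlogn]
      exact hne
    · have hj1 : j - 1 + 1 = j := by omega
      rw [hj1, hpow]
  · -- values agree
    intro m _ _
    rw [log_natPow]

/-! #### Positive-definiteness of the autocorrelation -/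

/-- `A_g(x - x') = ∫ g(y + x) conj(g(y + x')) dy`. [folklore] -/
theorem weilConv_weilReflect_sub_eq (g : ℝ → ℂ) (x x' : ℝ) :
    weilConv g (weilReflect g) (x - x') = ∫ y : ℝ, g (y + x) * conj (g (y + x')) := by
  rw [weilConv_apply, ← integral_add_right_eq_self _ x]
  refine integral_congr_ae (Eventually.of_forall fun y ↦ ?_)
  have : -(x - x' - (y + x)) = y + x' := by ring
  simp only [weilReflect, this]

/-- **Positive-definiteness of `g ⋆ g̃`:** `Re Σ_{n,m<N} c_n c̄_m A_g(x_n - x_m) ≥ 0`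
(it equals `∫ |Σ_n c_n g(· + x_n)|²`). [folklore] -/
theorem re_sum_sum_autocorr_nonneg (hg : IsWeilTest g) (c : ℕ → ℂ) (x : ℕ → ℝ) (N : ℕ) :
    0 ≤ (∑ n ∈ Finset.range N, ∑ m ∈ Finset.range N,
      c n * conj (c m) * weilConv g (weilReflect g) (x n - x m)).re := by
  set G : ℝ → ℂ := fun y ↦ ∑ n ∈ Finset.range N, c n * g (y + x n) with hG
  have hgc : ∀ a : ℝ, Continuous fun y ↦ g (y + a) := fun a ↦ hg.1.continuous.comp (continuous_add_const a)
  have hgs : ∀ a : ℝ, HasCompactSupport fun y ↦ g (y + a) := fun a ↦ by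
    simpa [Function.comp_def] using hg.2.comp_homeomorph (Homeomorph.addRight a)
  have hint : ∀ n m : ℕ, Integrable fun y ↦ c n * conj (c m) * (g (y + x n) * conj (g (y + x m))) := by
    intro n m
    refine Integrable.const_mul ?_ _
    exact (((hgc (x n)).mul (Complex.continuous_conj.comp (hgc (x m)))).integrable_of_hasCompactSupport
      ((hgs (x n)).mul_right))
  have hsum : (∑ n ∈ Finset.range N, ∑ m ∈ Finset.range N,
      c n * conj (c m) * weilConv g (weilReflect g) (x n - x m)) = ∫ y : ℝ, G y * conj (G y) := by
    have hpt : ∀ y : ℝ, G y * conj (G y) = ∑ n ∈ Finset.range N, ∑ m ∈ Finset.range N,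
        c n * conj (c m) * (g (y + x n) * conj (g (y + x m))) := by
      intro y
      simp only [hG, map_sum, map_mul, Finset.sum_mul_sum]
      refine Finset.sum_congr rfl fun n _ ↦ Finset.sum_congr rfl fun m _ ↦ by ring
    simp_rw [hpt]
    rw [integral_finsetSum _ fun n _ ↦ integrable_finsetSum _ fun m _ ↦ hint n m]
    refine Finset.sum_congr rfl fun n _ ↦ ?_
    rw [integral_finsetSum _ fun m _ ↦ hint n m]
    refine Finset.sum_congr rfl fun m _ ↦ ?_
    rw [integral_const_mul, weilConv_weilReflect_sub_eq]
  have hsq : ∀ y : ℝ, G y * conj (G y) = ((‖G y‖ ^ 2 : ℝ) : ℂ) := by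
    intro y; rw [Complex.mul_conj, Complex.normSq_eq_norm_sq]
  rw [hsum]
  simp_rw [hsq]
  rw [integral_complex_ofReal, Complex.ofReal_re]
  exact integral_nonneg fun y ↦ by positivity

/-! #### Fejér summation of Toeplitz double sums -/

/-- Symmetric partial sums `P_r(f) = f 0 + Σ_{1 ≤ j ≤ r} (f j + f (-j))`. [folklore] -/
def Psum (f : ℤ → ℂ) (r : ℕ) : ℂ :=
  f 0 + ∑ j ∈ Finset.range r, (f ((j : ℤ) + 1) + f (-((j : ℤ) + 1)))

/-- Fejér: `Σ_{n,m<N} f(n - m) = Σ_{r<N} P_r(f)`. [folklore] -/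
theorem sum_sum_sub_eq_sum_Psum (f : ℤ → ℂ) (N : ℕ) :
    (∑ n ∈ Finset.range N, ∑ m ∈ Finset.range N, f ((n : ℤ) - m)) =
      ∑ r ∈ Finset.range N, Psum f r := by
  induction N with
  | zero => simp
  | succ N ih =>
    simp only [Finset.sum_range_succ]
    rw [Finset.sum_add_distrib, ih, sub_self]
    have h1 : (∑ n ∈ Finset.range N, f ((n : ℤ) - N)) =
        ∑ j ∈ Finset.range N, f (-((j : ℤ) + 1)) := by
      rw [← Finset.sum_range_reflect]
      refine Finset.sum_congr rfl fun j hj ↦ ?_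
      rw [Finset.mem_range] at hj
      congr 1
      rw [Nat.cast_sub (by omega), Nat.cast_sub (by omega)]; push_cast; ring
    have h2 : (∑ m ∈ Finset.range N, f ((N : ℤ) - m)) =
        ∑ j ∈ Finset.range N, f ((j : ℤ) + 1) := by
      rw [← Finset.sum_range_reflect]
      refine Finset.sum_congr rfl fun j hj ↦ ?_
      rw [Finset.mem_range] at hj
      congr 1
      rw [Nat.cast_sub (by omega), Nat.cast_sub (by omega)]; push_cast; ring
    rw [h1, h2]
    unfold Psum
    simp only [Finset.sum_add_distrib]
    ring

/-- Beyond the support the partial sums are constant. [folklore] -/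
theorem Psum_eq_of_vanish (f : ℤ → ℂ) {M : ℕ} (hf : ∀ k : ℤ, (M : ℤ) < |k| → f k = 0) {r : ℕ}
    (hr : M ≤ r) : Psum f r = Psum f M := by
  induction r, hr using Nat.le_induction with
  | base => rfl
  | succ r hr ih =>
    unfold Psum at ih ⊢
    rw [Finset.sum_range_succ, ← add_assoc]
    rw [hf ((r : ℤ) + 1) (by rw [abs_of_nonneg (by positivity)]; omega),
      hf (-((r : ℤ) + 1)) (by rw [abs_neg, abs_of_nonneg (by positivity)]; omega), add_zero, add_zero]
    exact ih

/-- Fejér's lemma: positive Toeplitz double sums and eventually-constant partial sums force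
`Re P_M(f) ≥ 0`. [folklore] -/
theorem re_Psum_nonneg (f : ℤ → ℂ) (M : ℕ)
    (hpd : ∀ N : ℕ, 0 ≤ (∑ n ∈ Finset.range N, ∑ m ∈ Finset.range N, f ((n : ℤ) - m)).re)
    (hf : ∀ k : ℤ, (M : ℤ) < |k| → f k = 0) : 0 ≤ (Psum f M).re := by
  by_contra hneg
  push Not at hneg
  set C : ℝ := (∑ r ∈ Finset.range M, Psum f r).re with hC
  have key : ∀ n : ℕ, (∑ r ∈ Finset.range (M + n), Psum f r) =
      (∑ r ∈ Finset.range M, Psum f r) + n * Psum f M := by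
    intro n
    induction n with
    | zero => simp
    | succ n ih =>
      rw [← add_assoc, Finset.sum_range_succ, ih, Psum_eq_of_vanish f hf (Nat.le_add_right M n)]
      push_cast; ring
  obtain ⟨n, hn⟩ := exists_nat_gt (C / (-(Psum f M).re))
  have h := hpd (M + n)
  rw [sum_sum_sub_eq_sum_Psum, key] at h
  simp only [Complex.add_re, Complex.mul_re, Complex.natCast_re, Complex.natCast_im, zero_mul,
    sub_zero] at h
  have hpos : 0 < -(Psum f M).re := by linarith
  have h3 : C < n * (-(Psum f M).re) := by rwa [div_lt_iff₀ hpos] at hn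
  rw [← hC] at h
  linarith


end F3T

end Summit.RiemannHypothesis.RiemannHypothesis.Theorems.PfPersistenceBarrier
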